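import Mathlib.Analysis.InnerProductSpace.Basic
import Literature.MathematicalPhysics.QuantumFieldTheory.Balaban1983to89.B4Eq19LatticeOperators
import HarnessLib

/-!
# Line «poincare_lipschitz» on crux `HistoryTailL` (stmt-QuantumFields-19936), route crux `BlockLipschitzL` (stmt-QuantumFields-23533), K2 organ of record LOC-REG-MIN —
# FLAT SHADOW «ENERGY → RANGE» (E→R) FOR LATTICE MINIMISERS INTO A SPHERE, FILE 2a: BOX-AVERAGE LETTERS FOR SPHERE-VALUED LATTICE MAPS — the exact near-sphere
# identity `‖Σ w_i u_i‖² = 1 − Σ w_i ‖u_i − Σ w_j u_j‖²` for unit vectors and convex weights, Jensen for means, variance minimality, the radial projection is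
# `m⁻¹`-Lipschitz on `{‖v‖ ≥ m}` with the energy comparison `E(π∘v) ≤ m⁻²·E(v)`, the adjacent-centre identity for box means and the one-step energy contraction
# `Σ_{x ∈ Q_ρ(z)} ‖ū_σ(x+e_μ) − ū_σ(x)‖² ≤ Σ_{y ∈ Q_{ρ+σ}(z)} ‖u(y+e_μ) − u(y)‖²`, nested means

Cell `ym3-torus` (YM ladder rung R3 = continuum SU(2) Yang–Mills on the three-torus — a RUNG, NOT the Clay problem: not d = 4, not infinite volume, not a mass gap); width seat
`ym-ust-19936-w5` gen 12 (LEAD ym-ust-19936-w1 g8 2026-08-29T04:55:44Z ∕ 05:00:37Z «E→R — GO … F1→F2 GO as you default»; my LOCATE `E2R-ROAD-w5g12.md` (19936∕23533 evidence)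
§2 steps (iii)(iv), §3 brick F2).  THEOREMS ONLY (def-free: the mean over a finset `Q` is written `(#Q)⁻¹ • Σ_{y ∈ Q} u y` throughout), values in ANY real inner-product space
`V` (`V = ℝ⁴ ⊃ S³ ≅ SU(2)` is the instance of record), lattice letters of lit ✓`B4Eq19LatticeOperators` (`Zd`, `box`, `unitVec`); `--supports stmt-QuantumFields-19936`.
Nothing here proves E→R, LOC-REG-MIN, `hReg`, hG, a per-bond chart, a stub, `BlockLipschitzL`, `HistoryTailL` or a summit statement; nothing twisted ∕ covariant is in this file.

WHY (E→R road, `E2R-ROAD-w5g12.md` §2): the Schoen–Uhlenbeck competitor in the boundary layer is `x ↦ π(ū_{σ(x)}(x))`, `ū_σ(x)` the mean of `u` over `Q_σ(x)`,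
`π(v) = v∕‖v‖`; one needs (iii) `1 − ‖ū_σ(x)‖² = avg_{Q_σ(x)} ‖u − ū_σ(x)‖²` EXACTLY (so near-sphere-ness is a Poincaré quantity), (iv) per-bond energy of the mollified
map `≤` the local average of the energy of `u` (adjacent centres: an exact identity + Jensen; then a double count over centres), and the Lipschitz bound of `π` off the
origin.  All of it is here, for finsets first and lattice boxes second:
* §1 ★ `sum_mul_normSq_sub_wmean_eq` (`Σ_i w_i‖u_i − m‖² = 1 − ‖m‖²`, `m = Σ_i w_i u_i`, `Σ w_i = 1`, `‖u_i‖ = 1` — no sign condition on `w`), ★ `normSq_mean_eq_one_sub`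
  (the box-mean instance `‖m‖² = 1 − (#Q)⁻¹Σ‖u − m‖²`), `norm_mean_le_one`, ★ `one_sub_norm_mean_le` (`1 − ‖m‖ ≤ (#Q)⁻¹Σ_Q‖u − m‖²`);
* §2 `sum_normSq_sub_eq_add` (`Σ_Q‖v − c‖² = Σ_Q‖v − m‖² + #Q·‖m − c‖²`), ★ `sum_normSq_sub_mean_le` (variance minimality), ★ `normSq_mean_le` (Jensen
  `‖(#Q)⁻¹ΣQ v‖² ≤ (#Q)⁻¹Σ_Q‖v‖²`), ★ `normSq_mean_sub_mean_le_of_subset` (nested means: `Q′ ⊆ Q` ⟹ `‖m_{Q′} − m_Q‖² ≤ (#Q′)⁻¹·Σ_Q‖v − m_Q‖²`);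
* §3 ★ `normSq_normalize_sub_normalize_mul_le` (`‖a∕‖a‖ − b∕‖b‖‖²·(‖a‖‖b‖) ≤ ‖a − b‖²`, AM–GM), ★★ `norm_normalize_sub_normalize_le` (`π` is `m⁻¹`-Lipschitz on `{‖v‖ ≥ m}`),
  ★ `energy_normalize_le` (`Σ_{y∈Q}Σ_μ‖π v(y+e_μ) − π v(y)‖² ≤ m⁻²·Σ_{y∈Q}Σ_μ‖v(y+e_μ) − v(y)‖²`);
* §4 `sum_box_shift` (`Σ_{Q_σ(x+e_μ)} u = Σ_{Q_σ(x)} u(· + e_μ)`), ★ `boxMean_shift_sub_eq` (ADJACENT CENTRES, exact: `ū_σ(x+e_μ) − ū_σ(x) = (#Q_σ)⁻¹•Σ_{Q_σ(x)} ∂_μu`),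
  ★ `normSq_boxMean_shift_sub_le` (Jensen: `‖ū_σ(x+e_μ) − ū_σ(x)‖² ≤ (#Q_σ)⁻¹Σ_{Q_σ(x)}‖∂_μu‖²`), `sum_sum_box_le_card_mul_sum` (DOUBLE COUNT over centres:
  `Σ_{x∈Q_ρ(z)}Σ_{y∈Q_σ(x)} f y ≤ #Q_σ·Σ_{y∈Q_{ρ+σ}(z)} f y` for `f ≥ 0`), ★★ `energy_boxMean_le` (ONE-STEP ENERGY CONTRACTION OF THE MOLLIFIER:
  `Σ_{x∈Q_ρ(z)}‖ū_σ(x+e_μ) − ū_σ(x)‖² ≤ Σ_{y∈Q_{ρ+σ}(z)}‖u(y+e_μ) − u(y)‖²`).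
[folklore] ([SchoenUhlenbeck1982] §4 (mollified comparison maps stay near `N`: `dist(u_σ, N)² ≤ avg|u − u_σ|²`); [Giaquinta1984] Ch. III §1 (means, Jensen); the lattice
statements are this file's).
-/

set_option autoImplicit false

noncomputable section

open scoped BigOperators InnerProductSpace
open Finset

namespace Summit.QuantumFields.YangMills.Theorems.PoincareLipschitzSphereMapBoxAverageLetters

open Literature.MathematicalPhysics.QuantumFieldTheory.Balaban1983to89
open B4Eq19LatticeOperators

variable {d : ℕ} {V : Type*} [NormedAddCommGroup V] [InnerProductSpace ℝ V]

/-! ## §1 The exact near-sphere identity for weighted means of unit vectors -/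

/-- ★ **`Σ_i w_i ‖u_i − m‖² = 1 − ‖m‖²`** for `m = Σ_i w_i • u_i`, weights with `Σ_i w_i = 1` (no sign condition) and UNIT vectors `u_i`. [folklore]
[cite: SchoenUhlenbeck1982, §4 (`dist(u_σ, N)` via the averaged oscillation)] -/
theorem sum_mul_normSq_sub_wmean_eq {ι : Type*} (s : Finset ι) (w : ι → ℝ) (u : ι → V) (hw : ∑ i ∈ s, w i = 1) (hu : ∀ i ∈ s, ‖u i‖ = 1) :
    ∑ i ∈ s, w i * ‖u i - ∑ j ∈ s, w j • u j‖ ^ 2 = 1 - ‖∑ j ∈ s, w j • u j‖ ^ 2 := by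
  set m : V := ∑ j ∈ s, w j • u j with hm
  have hterm : ∀ i ∈ s, w i * ‖u i - m‖ ^ 2 = w i - 2 * (w i * ⟪u i, m⟫_ℝ) + w i * ‖m‖ ^ 2 := by
    intro i hi
    rw [@norm_sub_sq_real, hu i hi]; ring
  rw [Finset.sum_congr rfl hterm, Finset.sum_add_distrib, Finset.sum_sub_distrib, hw, ← Finset.mul_sum, ← Finset.sum_mul, hw, one_mul]
  have hinner : ∑ i ∈ s, w i * ⟪u i, m⟫_ℝ = ‖m‖ ^ 2 := by
    have e : ∑ i ∈ s, w i * ⟪u i, m⟫_ℝ = ⟪∑ i ∈ s, w i • u i, m⟫_ℝ := by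
      rw [sum_inner]; exact Finset.sum_congr rfl fun i _ => by rw [real_inner_smul_left]
    rw [e, ← hm, real_inner_self_eq_norm_sq]
  rw [hinner]; ring

/-- ★ **THE BOX-MEAN INSTANCE**: for a nonempty finset `Q` and unit vectors `u y` (`y ∈ Q`), with `m = (#Q)⁻¹ • Σ_Q u`:
`‖m‖² = 1 − (#Q)⁻¹ · Σ_{y∈Q} ‖u y − m‖²`.  Near-sphere-ness of a mean is EXACTLY an averaged oscillation. [folklore]
[cite: SchoenUhlenbeck1982, §4] -/
theorem normSq_mean_eq_one_sub {α : Type*} (Q : Finset α) (hQ : Q.Nonempty) (u : α → V) (hu : ∀ y ∈ Q, ‖u y‖ = 1) :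
    ‖((Q.card : ℝ))⁻¹ • ∑ y ∈ Q, u y‖ ^ 2 = 1 - ((Q.card : ℝ))⁻¹ * ∑ y ∈ Q, ‖u y - ((Q.card : ℝ))⁻¹ • ∑ y' ∈ Q, u y'‖ ^ 2 := by
  have hc : (Q.card : ℝ) ≠ 0 := by exact_mod_cast hQ.card_pos.ne'
  have hw : ∑ _i ∈ Q, ((Q.card : ℝ))⁻¹ = 1 := by
    rw [Finset.sum_const, nsmul_eq_mul, mul_inv_cancel₀ hc]
  have h := sum_mul_normSq_sub_wmean_eq Q (fun _ => ((Q.card : ℝ))⁻¹) u hw hu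
  have e : ∑ j ∈ Q, ((Q.card : ℝ))⁻¹ • u j = ((Q.card : ℝ))⁻¹ • ∑ y ∈ Q, u y := by rw [Finset.smul_sum]
  rw [e, ← Finset.mul_sum] at h
  linarith

/-- The mean of unit vectors has norm `≤ 1`. [folklore] -/
theorem norm_mean_le_one {α : Type*} (Q : Finset α) (hQ : Q.Nonempty) (u : α → V) (hu : ∀ y ∈ Q, ‖u y‖ = 1) :
    ‖((Q.card : ℝ))⁻¹ • ∑ y ∈ Q, u y‖ ≤ 1 := by
  have hc : (0 : ℝ) < Q.card := by exact_mod_cast hQ.card_pos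
  rw [norm_smul, Real.norm_eq_abs, abs_of_pos (inv_pos.2 hc)]
  calc ((Q.card : ℝ))⁻¹ * ‖∑ y ∈ Q, u y‖ ≤ ((Q.card : ℝ))⁻¹ * ∑ y ∈ Q, ‖u y‖ :=
        mul_le_mul_of_nonneg_left (norm_sum_le _ _) (inv_pos.2 hc).le
    _ = ((Q.card : ℝ))⁻¹ * Q.card := by rw [Finset.sum_congr rfl hu, Finset.sum_const, nsmul_eq_mul, mul_one]
    _ = 1 := inv_mul_cancel₀ hc.ne'

/-- ★ **NEAR THE SPHERE**: `1 − ‖m‖ ≤ (#Q)⁻¹ · Σ_{y∈Q} ‖u y − m‖²` for the mean `m` of unit vectors (`1 − ‖m‖ ≤ 1 − ‖m‖²` as `‖m‖ ≤ 1`). [folklore]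
[cite: SchoenUhlenbeck1982, §4] -/
theorem one_sub_norm_mean_le {α : Type*} (Q : Finset α) (hQ : Q.Nonempty) (u : α → V) (hu : ∀ y ∈ Q, ‖u y‖ = 1) :
    1 - ‖((Q.card : ℝ))⁻¹ • ∑ y ∈ Q, u y‖ ≤ ((Q.card : ℝ))⁻¹ * ∑ y ∈ Q, ‖u y - ((Q.card : ℝ))⁻¹ • ∑ y' ∈ Q, u y'‖ ^ 2 := by
  have h1 := normSq_mean_eq_one_sub Q hQ u hu
  have h2 := norm_mean_le_one Q hQ u hu
  have h0 : 0 ≤ ‖((Q.card : ℝ))⁻¹ • ∑ y ∈ Q, u y‖ := norm_nonneg _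
  nlinarith

/-! ## §2 Variance minimality, Jensen, nested means (any `V`, no unit hypothesis) -/

/-- **`Σ_Q ‖v − c‖² = Σ_Q ‖v − m‖² + #Q·‖m − c‖²`** for the mean `m = (#Q)⁻¹•Σ_Q v` (`Q` nonempty) and any `c` (the cross term vanishes). [folklore]
[cite: Giaquinta1984, Ch. III §1 p.64] -/
theorem sum_normSq_sub_eq_add {α : Type*} (Q : Finset α) (hQ : Q.Nonempty) (v : α → V) (c : V) :
    ∑ y ∈ Q, ‖v y - c‖ ^ 2 = ∑ y ∈ Q, ‖v y - ((Q.card : ℝ))⁻¹ • ∑ y' ∈ Q, v y'‖ ^ 2 + Q.card * ‖((Q.card : ℝ))⁻¹ • ∑ y' ∈ Q, v y' - c‖ ^ 2 := by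
  set m : V := ((Q.card : ℝ))⁻¹ • ∑ y' ∈ Q, v y' with hm
  have hc : (Q.card : ℝ) ≠ 0 := by exact_mod_cast hQ.card_pos.ne'
  have hsum0 : ∑ y ∈ Q, (v y - m) = 0 := by
    rw [Finset.sum_sub_distrib, Finset.sum_const, hm, ← Nat.cast_smul_eq_nsmul ℝ, smul_smul, mul_inv_cancel₀ hc, one_smul, sub_self]
  have hterm : ∀ y ∈ Q, ‖v y - c‖ ^ 2 = ‖v y - m‖ ^ 2 + 2 * ⟪v y - m, m - c⟫_ℝ + ‖m - c‖ ^ 2 := by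
    intro y _
    have e : v y - c = (v y - m) + (m - c) := by abel
    rw [e, @norm_add_sq_real]
  rw [Finset.sum_congr rfl hterm, Finset.sum_add_distrib, Finset.sum_add_distrib, ← Finset.mul_sum, ← sum_inner, hsum0, inner_zero_left,
    mul_zero, add_zero, Finset.sum_const, nsmul_eq_mul]

/-- ★ **VARIANCE MINIMALITY**: `Σ_Q ‖v − m‖² ≤ Σ_Q ‖v − c‖²` for the mean `m` and every constant `c`. [folklore] [cite: Giaquinta1984, Ch. III §1 p.64] -/
theorem sum_normSq_sub_mean_le {α : Type*} (Q : Finset α) (hQ : Q.Nonempty) (v : α → V) (c : V) :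
    ∑ y ∈ Q, ‖v y - ((Q.card : ℝ))⁻¹ • ∑ y' ∈ Q, v y'‖ ^ 2 ≤ ∑ y ∈ Q, ‖v y - c‖ ^ 2 := by
  rw [sum_normSq_sub_eq_add Q hQ v c]
  have : 0 ≤ (Q.card : ℝ) * ‖((Q.card : ℝ))⁻¹ • ∑ y' ∈ Q, v y' - c‖ ^ 2 := by positivity
  linarith

/-- ★ **JENSEN FOR THE MEAN**: `‖(#Q)⁻¹•Σ_Q v‖² ≤ (#Q)⁻¹·Σ_Q ‖v‖²` (`Q` nonempty). [folklore] [cite: Giaquinta1984, Ch. III §1 p.64] -/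
theorem normSq_mean_le {α : Type*} (Q : Finset α) (hQ : Q.Nonempty) (v : α → V) :
    ‖((Q.card : ℝ))⁻¹ • ∑ y ∈ Q, v y‖ ^ 2 ≤ ((Q.card : ℝ))⁻¹ * ∑ y ∈ Q, ‖v y‖ ^ 2 := by
  have hc : (0 : ℝ) < Q.card := by exact_mod_cast hQ.card_pos
  have h := sum_normSq_sub_eq_add Q hQ v 0
  simp only [sub_zero] at h
  have h0 : 0 ≤ ∑ y ∈ Q, ‖v y - ((Q.card : ℝ))⁻¹ • ∑ y' ∈ Q, v y'‖ ^ 2 := Finset.sum_nonneg fun _ _ => by positivity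
  rw [le_inv_mul_iff₀ hc]
  linarith

/-- ★ **NESTED MEANS**: for `Q′ ⊆ Q`, `Q′` nonempty, `‖m_{Q′} − m_Q‖² ≤ (#Q′)⁻¹ · Σ_{y∈Q} ‖v y − m_Q‖²` (Jensen on `Q′` for `v − m_Q`, then enlarge the sum).
[folklore] [cite: Giaquinta1984, Ch. III §1 p.65] -/
theorem normSq_mean_sub_mean_le_of_subset {α : Type*} {Q Q' : Finset α} (hsub : Q' ⊆ Q) (hQ' : Q'.Nonempty) (v : α → V) :
    ‖((Q'.card : ℝ))⁻¹ • ∑ y ∈ Q', v y - ((Q.card : ℝ))⁻¹ • ∑ y ∈ Q, v y‖ ^ 2 ≤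
      ((Q'.card : ℝ))⁻¹ * ∑ y ∈ Q, ‖v y - ((Q.card : ℝ))⁻¹ • ∑ y' ∈ Q, v y'‖ ^ 2 := by
  set m : V := ((Q.card : ℝ))⁻¹ • ∑ y ∈ Q, v y with hm
  have hc' : (Q'.card : ℝ) ≠ 0 := by exact_mod_cast hQ'.card_pos.ne'
  have hc'0 : (0 : ℝ) ≤ ((Q'.card : ℝ))⁻¹ := by positivity
  -- the mean over `Q'` of `v − m` is `m_{Q'} − m`
  have e : ((Q'.card : ℝ))⁻¹ • ∑ y ∈ Q', v y - m = ((Q'.card : ℝ))⁻¹ • ∑ y ∈ Q', (v y - m) := by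
    rw [Finset.sum_sub_distrib, Finset.sum_const, smul_sub, ← Nat.cast_smul_eq_nsmul ℝ, smul_smul, inv_mul_cancel₀ hc', one_smul]
  rw [e]
  calc ‖((Q'.card : ℝ))⁻¹ • ∑ y ∈ Q', (v y - m)‖ ^ 2 ≤ ((Q'.card : ℝ))⁻¹ * ∑ y ∈ Q', ‖v y - m‖ ^ 2 := normSq_mean_le Q' hQ' _
    _ ≤ ((Q'.card : ℝ))⁻¹ * ∑ y ∈ Q, ‖v y - m‖ ^ 2 :=
        mul_le_mul_of_nonneg_left (Finset.sum_le_sum_of_subset_of_nonneg hsub fun _ _ _ => by positivity) hc'0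

/-! ## §3 The radial projection is `m⁻¹`-Lipschitz off the ball of radius `m` -/

/-- ★ **`‖a∕‖a‖ − b∕‖b‖‖² · (‖a‖·‖b‖) ≤ ‖a − b‖²`** for `a, b ≠ 0` (expand both sides; AM–GM `2‖a‖‖b‖ ≤ ‖a‖² + ‖b‖²`). [folklore] -/
theorem normSq_normalize_sub_normalize_mul_le {a b : V} (ha : a ≠ 0) (hb : b ≠ 0) :
    ‖(‖a‖)⁻¹ • a - (‖b‖)⁻¹ • b‖ ^ 2 * (‖a‖ * ‖b‖) ≤ ‖a - b‖ ^ 2 := by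
  have hA : 0 < ‖a‖ := norm_pos_iff.2 ha
  have hB : 0 < ‖b‖ := norm_pos_iff.2 hb
  have h1 : ‖(‖a‖)⁻¹ • a - (‖b‖)⁻¹ • b‖ ^ 2 = 2 - 2 * ((‖a‖)⁻¹ * (‖b‖)⁻¹ * ⟪a, b⟫_ℝ) := by
    rw [@norm_sub_sq_real, norm_smul, norm_smul, Real.norm_eq_abs, Real.norm_eq_abs, abs_of_pos (inv_pos.2 hA), abs_of_pos (inv_pos.2 hB),
      inv_mul_cancel₀ hA.ne', inv_mul_cancel₀ hB.ne', real_inner_smul_left, real_inner_smul_right]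
    ring
  have h2 : ‖a - b‖ ^ 2 = ‖a‖ ^ 2 - 2 * ⟪a, b⟫_ℝ + ‖b‖ ^ 2 := @norm_sub_sq_real _ _ _ a b
  rw [h1, h2]
  have e : (2 - 2 * ((‖a‖)⁻¹ * (‖b‖)⁻¹ * ⟪a, b⟫_ℝ)) * (‖a‖ * ‖b‖) = 2 * (‖a‖ * ‖b‖) - 2 * ⟪a, b⟫_ℝ := by
    field_simp
  rw [e]
  nlinarith [sq_nonneg (‖a‖ - ‖b‖)]

/-- ★★ **THE RADIAL PROJECTION IS `m⁻¹`-LIPSCHITZ ON `{‖v‖ ≥ m}`**: `0 < m ≤ ‖a‖, ‖b‖` ⟹ `‖a∕‖a‖ − b∕‖b‖‖ ≤ ‖a − b‖ ∕ m`. [folklore]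
[cite: SchoenUhlenbeck1982, §4 (projection of the mollified map back to `N`)] -/
theorem norm_normalize_sub_normalize_le {a b : V} {m : ℝ} (hm : 0 < m) (ha : m ≤ ‖a‖) (hb : m ≤ ‖b‖) :
    ‖(‖a‖)⁻¹ • a - (‖b‖)⁻¹ • b‖ ≤ ‖a - b‖ / m := by
  have hA : 0 < ‖a‖ := hm.trans_le ha
  have hB : 0 < ‖b‖ := hm.trans_le hb
  have ha0 : a ≠ 0 := norm_pos_iff.1 hA
  have hb0 : b ≠ 0 := norm_pos_iff.1 hB
  have h := normSq_normalize_sub_normalize_mul_le ha0 hb0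
  have hmm : m ^ 2 ≤ ‖a‖ * ‖b‖ := by nlinarith
  have hP : 0 ≤ ‖(‖a‖)⁻¹ • a - (‖b‖)⁻¹ • b‖ := norm_nonneg _
  have h3 : ‖(‖a‖)⁻¹ • a - (‖b‖)⁻¹ • b‖ ^ 2 * m ^ 2 ≤ ‖a - b‖ ^ 2 :=
    (mul_le_mul_of_nonneg_left hmm (sq_nonneg _)).trans h
  have h4 : (‖(‖a‖)⁻¹ • a - (‖b‖)⁻¹ • b‖ * m) ^ 2 ≤ ‖a - b‖ ^ 2 := by rw [mul_pow]; exact h3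
  have h5 : ‖(‖a‖)⁻¹ • a - (‖b‖)⁻¹ • b‖ * m ≤ ‖a - b‖ := by
    have := Real.sqrt_le_sqrt h4
    rwa [Real.sqrt_sq (mul_nonneg hP hm.le), Real.sqrt_sq (norm_nonneg _)] at this
  rw [le_div_iff₀ hm]; exact h5

/-- ★ **ENERGY COMPARISON FOR THE PROJECTED MAP**: if `‖v‖ ≥ m > 0` on `Q` and on `Q + e_μ` (all `μ`), then
`Σ_{y∈Q} Σ_μ ‖π v(y+e_μ) − π v(y)‖² ≤ m⁻² · Σ_{y∈Q} Σ_μ ‖v(y+e_μ) − v(y)‖²`, `π v = ‖v‖⁻¹ • v`. [folklore] [cite: SchoenUhlenbeck1982, §4] -/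
theorem energy_normalize_le (Q : Finset (Zd d)) (v : Zd d → V) {m : ℝ} (hm : 0 < m) (hQ : ∀ y ∈ Q, m ≤ ‖v y‖)
    (hQ' : ∀ y ∈ Q, ∀ μ : Fin d, m ≤ ‖v (y + unitVec μ)‖) :
    ∑ y ∈ Q, ∑ μ, ‖(‖v (y + unitVec μ)‖)⁻¹ • v (y + unitVec μ) - (‖v y‖)⁻¹ • v y‖ ^ 2 ≤
      (m ^ 2)⁻¹ * ∑ y ∈ Q, ∑ μ, ‖v (y + unitVec μ) - v y‖ ^ 2 := by
  rw [Finset.mul_sum]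
  refine Finset.sum_le_sum fun y hy => ?_
  rw [Finset.mul_sum]
  refine Finset.sum_le_sum fun μ _ => ?_
  have h := norm_normalize_sub_normalize_le hm (hQ' y hy μ) (hQ y hy)
  have hP : 0 ≤ ‖(‖v (y + unitVec μ)‖)⁻¹ • v (y + unitVec μ) - (‖v y‖)⁻¹ • v y‖ := norm_nonneg _
  have h2 := pow_le_pow_left₀ hP h 2
  rw [div_pow] at h2
  rw [inv_mul_eq_div]; exact h2

/-! ## §4 Box means on `ℤ^d`: adjacent centres, Jensen, double count, one-step energy contraction -/

/-- Shifting the box: `Σ_{y ∈ Q_σ(x + e_μ)} u y = Σ_{y ∈ Q_σ(x)} u (y + e_μ)`. [folklore] -/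
theorem sum_box_shift {α : Type*} [AddCommMonoid α] (u : Zd d → α) (x : Zd d) (σ : ℤ) (μ : Fin d) :
    ∑ y ∈ box (x + unitVec μ) σ, u y = ∑ y ∈ box x σ, u (y + unitVec μ) :=
  (sum_box_add_right u x (unitVec μ) σ).symm

/-- All boxes of the same radius have the same cardinality. [folklore] -/
theorem card_box_eq_card_box (x x' : Zd d) (σ : ℤ) : (box x σ).card = (box x' σ).card := by
  have h := sum_box_add_right (fun _ : Zd d => (1 : ℕ)) x (x' - x) σ
  simp only [Finset.sum_const, smul_eq_mul, mul_one, add_sub_cancel] at h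
  exact h

/-- ★ **ADJACENT CENTRES, EXACT**: `ū_σ(x + e_μ) − ū_σ(x) = (#Q_σ)⁻¹ • Σ_{y ∈ Q_σ(x)} (u(y + e_μ) − u y)` — the difference of the means over two adjacent boxes is the
mean of the forward differences. [folklore] -/
theorem boxMean_shift_sub_eq (u : Zd d → V) (x : Zd d) (σ : ℤ) (μ : Fin d) :
    (((box (x + unitVec μ) σ).card : ℝ))⁻¹ • ∑ y ∈ box (x + unitVec μ) σ, u y - (((box x σ).card : ℝ))⁻¹ • ∑ y ∈ box x σ, u y =
      (((box x σ).card : ℝ))⁻¹ • ∑ y ∈ box x σ, (u (y + unitVec μ) - u y) := by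
  rw [card_box_eq_card_box (x + unitVec μ) x σ, sum_box_shift, Finset.sum_sub_distrib, smul_sub]

/-- ★ **JENSEN FOR ADJACENT CENTRES**: `σ ≥ 0` ⟹ `‖ū_σ(x + e_μ) − ū_σ(x)‖² ≤ (#Q_σ)⁻¹ · Σ_{y ∈ Q_σ(x)} ‖u(y + e_μ) − u y‖²`. [folklore] -/
theorem normSq_boxMean_shift_sub_le (u : Zd d → V) (x : Zd d) {σ : ℤ} (hσ : 0 ≤ σ) (μ : Fin d) :
    ‖(((box (x + unitVec μ) σ).card : ℝ))⁻¹ • ∑ y ∈ box (x + unitVec μ) σ, u y - (((box x σ).card : ℝ))⁻¹ • ∑ y ∈ box x σ, u y‖ ^ 2 ≤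
      (((box x σ).card : ℝ))⁻¹ * ∑ y ∈ box x σ, ‖u (y + unitVec μ) - u y‖ ^ 2 := by
  rw [boxMean_shift_sub_eq]
  exact normSq_mean_le (box x σ) ⟨x, self_mem_box x hσ⟩ _

/-- **DOUBLE COUNT OVER CENTRES**: for `f ≥ 0` and any radii `ρ, σ`: `Σ_{x ∈ Q_ρ(z)} Σ_{y ∈ Q_σ(x)} f y ≤ #Q_σ · Σ_{y ∈ Q_{ρ+σ}(z)} f y` (each `y` lies in `Q_σ(x)` for at most
`#Q_σ(y) = #Q_σ` centres `x`). [folklore] -/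
theorem sum_sum_box_le_card_mul_sum (f : Zd d → ℝ) (hf : ∀ y, 0 ≤ f y) (z : Zd d) (ρ σ : ℤ) :
    ∑ x ∈ box z ρ, ∑ y ∈ box x σ, f y ≤ ((box z σ).card : ℝ) * ∑ y ∈ box z (ρ + σ), f y := by
  classical
  -- enlarge each inner sum to the big box with an indicator
  have hsub : ∀ x ∈ box z ρ, box x σ ⊆ box z (ρ + σ) := by
    intro x hx
    refine box_subset_box fun i => ?_
    have := (mem_box.1 hx) i
    linarith
  have h1 : ∀ x ∈ box z ρ, ∑ y ∈ box x σ, f y = ∑ y ∈ box z (ρ + σ), (if y ∈ box x σ then f y else 0) := by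
    intro x hx
    rw [← Finset.sum_filter, Finset.filter_mem_eq_inter, Finset.inter_eq_right.2 (hsub x hx)]
  rw [Finset.sum_congr rfl h1, Finset.sum_comm, Finset.mul_sum]
  refine Finset.sum_le_sum fun y _ => ?_
  -- for fixed `y`, the number of centres `x` with `y ∈ Q_σ(x)` is at most `#Q_σ(y) = #Q_σ(z)`
  have h2 : ∑ x ∈ box z ρ, (if y ∈ box x σ then f y else 0) ≤ ∑ x ∈ box y σ, f y := by
    rw [← Finset.sum_filter]
    refine Finset.sum_le_sum_of_subset_of_nonneg ?_ fun _ _ _ => hf y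
    intro x hx
    rw [Finset.mem_filter] at hx
    exact mem_box_comm.1 hx.2
  refine h2.trans ?_
  rw [Finset.sum_const, nsmul_eq_mul, card_box_eq_card_box y z σ]

/-- ★★ **ONE-STEP ENERGY CONTRACTION OF THE MOLLIFIER**: `σ ≥ 0`, any `ρ` ⟹
`Σ_{x ∈ Q_ρ(z)} ‖ū_σ(x + e_μ) − ū_σ(x)‖² ≤ Σ_{y ∈ Q_{ρ+σ}(z)} ‖u(y + e_μ) − u(y)‖²` — averaging does not increase the Dirichlet energy (Jensen bond by bond, then the
double count over centres). [folklore] [cite: SchoenUhlenbeck1982, §4] -/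
theorem energy_boxMean_le (u : Zd d → V) (z : Zd d) (ρ : ℤ) {σ : ℤ} (hσ : 0 ≤ σ) (μ : Fin d) :
    ∑ x ∈ box z ρ, ‖(((box (x + unitVec μ) σ).card : ℝ))⁻¹ • ∑ y ∈ box (x + unitVec μ) σ, u y - (((box x σ).card : ℝ))⁻¹ • ∑ y ∈ box x σ, u y‖ ^ 2 ≤
      ∑ y ∈ box z (ρ + σ), ‖u (y + unitVec μ) - u y‖ ^ 2 := by
  have hc : (0 : ℝ) < (box z σ).card := by exact_mod_cast Finset.card_pos.2 ⟨z, self_mem_box z hσ⟩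
  calc ∑ x ∈ box z ρ, ‖(((box (x + unitVec μ) σ).card : ℝ))⁻¹ • ∑ y ∈ box (x + unitVec μ) σ, u y - (((box x σ).card : ℝ))⁻¹ • ∑ y ∈ box x σ, u y‖ ^ 2
        ≤ ∑ x ∈ box z ρ, (((box x σ).card : ℝ))⁻¹ * ∑ y ∈ box x σ, ‖u (y + unitVec μ) - u y‖ ^ 2 :=
          Finset.sum_le_sum fun x _ => normSq_boxMean_shift_sub_le u x hσ μ
    _ = (((box z σ).card : ℝ))⁻¹ * ∑ x ∈ box z ρ, ∑ y ∈ box x σ, ‖u (y + unitVec μ) - u y‖ ^ 2 := by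
          rw [Finset.mul_sum]
          exact Finset.sum_congr rfl fun x _ => by rw [card_box_eq_card_box x z σ]
    _ ≤ (((box z σ).card : ℝ))⁻¹ * (((box z σ).card : ℝ) * ∑ y ∈ box z (ρ + σ), ‖u (y + unitVec μ) - u y‖ ^ 2) :=
          mul_le_mul_of_nonneg_left (sum_sum_box_le_card_mul_sum (fun y => ‖u (y + unitVec μ) - u y‖ ^ 2) (fun _ => by positivity) z ρ σ)
            (inv_pos.2 hc).le
    _ = ∑ y ∈ box z (ρ + σ), ‖u (y + unitVec μ) - u y‖ ^ 2 := by rw [← mul_assoc, inv_mul_cancel₀ hc.ne', one_mul]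

end Summit.QuantumFields.YangMills.Theorems.PoincareLipschitzSphereMapBoxAverageLetters
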